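import Literature.NumberTheory.LFunctions.RationalExpSumLFunction
import Literature.NumberTheory.LFunctions.RationalExpSumCharacter
import Literature.NumberTheory.LFunctions.HybridCharSumArtinSchreier
import Literature.NumberTheory.LFunctions.PowerSumsBound
import Literature.NumberTheory.DiophantineGeometry.ArtinSchreierCurvePointCount
import HarnessLib

/-!
# Weil's bound `|Σ_{x ∈ 𝔽_p, Q(x) ≠ 0} ψ(P(x)/Q(x))| ≪ √p` for rational arguments — PROVED

Topic `Literature/NumberTheory/LFunctions` (exponential sums), grouping namespace
`RationalExpSum` (fifth file; see `RationalExpSumNewton`, `RationalExpSumLFunction`,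
`RationalExpSumInvariance`, `RationalExpSumCharacter`).  For a prime `p`, a non-trivial additive
character `ψ` of `𝔽_p` and `P, Q ∈ 𝔽_p[X]`, `Q ≠ 0`, `deg P, deg Q ≤ D < p`, `P ≠ a Q` for all
constants `a`, we prove A. Weil's bound (1948) for exponential sums with a rational argument,

  `|Σ_{x ∈ 𝔽_p, Q(x) ≠ 0} ψ(P(x)/Q(x))| ≤ 2D √p + D + 2`   (`norm_sum_le_of_ne_C_mul`),

and, in normalised form (`P, Q` coprime, `deg P ≤ deg Q`, `1 ≤ deg Q < p`, a zero `c₀ ∈ 𝔽_p` of `P`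
off the poles), `≤ (2 deg Q − 1) √p` (`norm_extSum_le_sqrt`, `norm_sum_div_le`), by the elementary
method of W. M. Schmidt's book (Ch. II) completed by the Riemann hypothesis for the Artin–Schreier
curve `zᵖ − z = P/Q` (the tree's `hasseWeil_holds`, through `ArtinSchreierCurvePointCount`):

* **§A Hasse–Weil input.** Summing the lifted sums
  `S_E(ψ₀^β) = Σ_{x ∈ E, Q(x) ≠ 0} ψ₀(β Tr_{E/𝔽_p}(P(x)/Q(x)))` over all twists `β ∈ 𝔽_p` counts the
  `E`-points of `zᵖ − z = P(x)/Q(x)` (`sum_extSum_mulShift_eq_card`, orthogonality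
  `#{z : zᵖ − z = w} = Σ_β ψ₀(β Tr w)`), i.e. the points of the plane model `Yᵖ − Qᵖ⁻¹Y − PQᵖ⁻¹`
  minus the roots of `Q` (`card_zeros_asPlaneModel_eq`); Weil's bound for that curve
  (`abs_card_zeros_asPlaneModel_sub_le`) gives `|Σ_{β ≠ 0} S_E(ψ₀^β)| ≤ (p−1)(kp−2)√#E + p(k+1) + 1`
  (`norm_sum_extSum_mulShift_le`).
* **§B The two cases of `RationalExpSumCharacter`.** `t_n = tFn n 1` is additive in the degree
  (`tFn_one_add`), so `t_{pμM} = 0` in characteristic `p`; in the *bad case* (`D ≡ 0`) the traces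
  `Tr_{E/𝔽_p}(P(x)/Q(x))` vanish on `E = 𝔽_{p^ν}`, `pμ ∣ ν`, outside the subfields of degree `< μ`
  (`trace_div_eq_zero_of_bad`), forcing `Re Σ_{β≠0} S_E(ψ_β) ≥ (p−1)(p^ν − deg Q − 2p^μ)`, which
  contradicts §A for `ν = 2pμC` (`not_bad`).  In the *good case* the `L`-functions of all twists are
  polynomials of degree `≤ μ − 1` (`lsumOf_lam_eq_zero`), `S_E(ψ_β) = −Σ_i ω_{β,i}^{[E:𝔽_p]}`
  (`exists_extSum_eq_neg_powerSum`), §A bounds the power sums of the `(p−1)(μ−1)` numbers `ω_{β,i}`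
  by `C(√p)^ν`, so `|ω_{β,i}| ≤ √p` (Schmidt's Lemma 6A, `norm_le_of_norm_powerSum_le`) and
  `|S(ψ)| ≤ (μ−1)√p` (`norm_extSum_le_of_good`, `norm_extSum_le_sqrt`).
* **§C Normalisations.** Möbius change of variable `x = c₁ + 1/y` (`norm_sum_sub_moebius_le`,
  error `≤ 2`; `P̂ = yᴺ P(c₁+1/y) = reflect N (taylor c₁ P)`), removal of `gcd(P̂, Q̂)`
  (`norm_sum_mul_sub_le`), after which `deg Q̂/G ≥ 1` because `P ≠ aQ` (`reflect`, `taylor` are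
  injective), and the twist `P ↦ P − rQ` (`norm_sum_sub_C_mul`) producing the rational zero.

No new named facts; the only definitions used are those of the sibling files.

## References

* A. Weil, *On some exponential sums*, Proc. Nat. Acad. Sci. USA 34 (1948) 204–207. [Weil1948]
* W. M. Schmidt, *Equations over Finite Fields. An Elementary Approach*, LNM 536, Springer 1976,
  Ch. II §2 (Theorem 2E), §6 (Lemma 6A), §§8–11 (Lemma 11C). [Schmidt1976]
-/

noncomputable section

open scoped Classical IntermediateField
open Finset Polynomial

namespace Literature.NumberTheory.LFunctions

namespace RationalExpSum

/-! ## §A. The Hasse–Weil input -/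

section HasseWeil

open Literature.NumberTheory.DiophantineGeometry.AlgFunctionField (asPlaneModel
  evalEval_asPlaneModel abs_card_zeros_asPlaneModel_sub_le)

variable {p : ℕ} [Fact p.Prime]
variable (K : Type*) [Field K] [Fintype K] [Algebra (ZMod p) K]

/-- `extSum` unfolded (any decidability instances). [folklore] -/
theorem extSum_eq [DecidableEq K] (ψ : AddChar (ZMod p) ℂ) (P Q : (ZMod p)[X]) :
    extSum ψ P Q K = ∑ x ∈ univ.filter (fun x : K => aeval x Q ≠ 0),
      ψ (Algebra.trace (ZMod p) K (aeval x P / aeval x Q)) := by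
  unfold extSum
  exact Finset.sum_congr (by ext; simp) fun _ _ => rfl

/-- The twist by `0` is the trivial character: `S_E(ψ₀⁰) = #{x ∈ E : Q(x) ≠ 0}`. [folklore] -/
theorem extSum_mulShift_zero (ψ₀ : AddChar (ZMod p) ℂ) (P Q : (ZMod p)[X]) :
    extSum (ψ₀.mulShift 0) P Q K = ((univ.filter fun x : K => aeval x Q ≠ 0).card : ℂ) := by
  classical
  rw [extSum_eq, AddChar.mulShift_zero]
  simp

/-- **Twisted sums count Artin–Schreier points**: for a primitive `ψ₀`,
`Σ_{β ∈ 𝔽_p} S_E(ψ₀^β) = #{(x, z) ∈ E² : Q(x) ≠ 0, zᵖ - z = P(x)/Q(x)}`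
(orthogonality, Schmidt II Lemma 11C). [cite: Schmidt1976, Ch. II §11, Lemma 11C] -/
theorem sum_extSum_mulShift_eq_card {ψ₀ : AddChar (ZMod p) ℂ} (hψ₀ : ψ₀.IsPrimitive)
    (P Q : (ZMod p)[X]) :
    ∑ β : ZMod p, extSum (ψ₀.mulShift β) P Q K =
      ((univ.filter fun xz : K × K =>
        aeval xz.1 Q ≠ 0 ∧ xz.2 ^ p - xz.2 = aeval xz.1 P / aeval xz.1 Q).card : ℂ) := by
  classical
  -- left side: swap the sums and use orthogonality fibrewise
  have hL : ∑ β : ZMod p, extSum (ψ₀.mulShift β) P Q K =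
      ∑ x ∈ univ.filter (fun x : K => aeval x Q ≠ 0),
        ((univ.filter fun z : K => z ^ p - z = aeval x P / aeval x Q).card : ℂ) := by
    simp_rw [extSum_eq, AddChar.mulShift_apply]
    rw [Finset.sum_comm]
    refine Finset.sum_congr rfl fun x _ => ?_
    have h := HybridLFunction.card_artinSchreier_fiber_eq_sum (ZMod p) K hψ₀
      (aeval x P / aeval x Q)
    rw [ZMod.card] at h
    exact h.symm
  -- right side: count the pairs fibrewise
  rw [Finset.card_filter, Fintype.sum_prod_type, hL, Finset.sum_filter]
  push_cast
  refine Finset.sum_congr rfl fun x _ => ?_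
  by_cases hQx : aeval x Q ≠ 0
  · rw [if_pos hQx, Finset.card_filter]
    push_cast
    refine Finset.sum_congr rfl fun z _ => ?_
    simp [hQx]
  · rw [if_neg hQx]
    symm
    refine Finset.sum_eq_zero fun z _ => ?_
    rw [if_neg (fun h => hQx h.1)]

/-- **Points of the plane model versus Artin–Schreier points.** For the plane model
`Φ = Yᵖ - Qᵖ⁻¹ Y - P Qᵖ⁻¹` over `E`:
`#{(a, b) ∈ E² : Φ(a, b) = 0} = #{(x, z) : Q(x) ≠ 0, zᵖ - z = P(x)/Q(x)} + #{x : Q(x) = 0}`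
(`b = Q(a) z` on the good fibres; the fibre over a root of `Q` is `bᵖ = 0`). [folklore] -/
theorem card_zeros_asPlaneModel_eq (P Q : (ZMod p)[X]) :
    (univ.filter fun ab : K × K =>
        (asPlaneModel p (P.map (algebraMap (ZMod p) K)) (Q.map (algebraMap (ZMod p) K))).evalEval
          ab.1 ab.2 = 0).card =
      (univ.filter fun xz : K × K =>
          aeval xz.1 Q ≠ 0 ∧ xz.2 ^ p - xz.2 = aeval xz.1 P / aeval xz.1 Q).card +
        (univ.filter fun x : K => aeval x Q = 0).card := by
  classical
  have hp : p.Prime := Fact.out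
  have hp1 : p - 1 ≠ 0 := by have := hp.two_le; omega
  set P' := P.map (algebraMap (ZMod p) K) with hP'
  set Q' := Q.map (algebraMap (ZMod p) K) with hQ'
  have hevQ : ∀ x : K, Q'.eval x = aeval x Q := fun x => by rw [hQ', eval_map, ← aeval_def]
  have hevP : ∀ x : K, P'.eval x = aeval x P := fun x => by rw [hP', eval_map, ← aeval_def]
  -- the three counts fibrewise
  have hN := Literature.NumberTheory.DiophantineGeometry.card_filter_evalEval_eq_sum
    (asPlaneModel p P' Q')
  have hA : (univ.filter fun xz : K × K =>
      aeval xz.1 Q ≠ 0 ∧ xz.2 ^ p - xz.2 = aeval xz.1 P / aeval xz.1 Q).card =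
      ∑ x : K, (univ.filter fun z : K => aeval x Q ≠ 0 ∧ z ^ p - z = aeval x P / aeval x Q).card := by
    rw [Finset.card_filter, Fintype.sum_prod_type]
    simp only [Finset.card_filter]
  have hZ : (univ.filter fun x : K => aeval x Q = 0).card = ∑ x : K, if aeval x Q = 0 then 1 else 0 :=
    Finset.card_filter _ _
  rw [hN, hA, hZ, ← Finset.sum_add_distrib]
  refine Finset.sum_congr rfl fun x _ => ?_
  simp only [evalEval_asPlaneModel, hevQ, hevP]
  set c := aeval x Q with hc
  by_cases hQx : c = 0
  · -- the fibre over a root of `Q` is `bᵖ = 0`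
    rw [if_pos hQx]
    have h1 : (univ.filter fun b : K =>
        b ^ p - c ^ (p - 1) * b - aeval x P * c ^ (p - 1) = 0).card = 1 := by
      rw [Finset.card_eq_one]
      refine ⟨0, ?_⟩
      ext b
      simp only [Finset.mem_filter, Finset.mem_univ, true_and, Finset.mem_singleton, hQx,
        zero_pow hp1, zero_mul, mul_zero, sub_zero]
      exact pow_eq_zero_iff hp.ne_zero
    have h2 : (univ.filter fun z : K => c ≠ 0 ∧ z ^ p - z = aeval x P / c).card = 0 := by
      rw [Finset.card_eq_zero, Finset.filter_eq_empty_iff]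
      intro z _ h
      exact h.1 hQx
    rw [h1, h2]
  · -- good fibre: `b = Q(x) z`
    rw [if_neg hQx, add_zero]
    have hcp : c ^ p = c ^ (p - 1) * c := (pow_sub_one_mul hp.ne_zero c).symm
    have hident : ∀ z : K, (c * z) ^ p - c ^ (p - 1) * (c * z) - aeval x P * c ^ (p - 1) =
        c ^ (p - 1) * ((z ^ p - z) * c - aeval x P) := fun z => by
      rw [mul_pow, hcp]; ring
    have hfilt : (univ.filter fun z : K => c ≠ 0 ∧ z ^ p - z = aeval x P / c) =
        univ.filter fun z : K => (z ^ p - z) * c = aeval x P := by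
      refine Finset.filter_congr fun z _ => ?_
      rw [eq_div_iff hQx]
      exact ⟨fun h => h.2, fun h => ⟨hQx, h⟩⟩
    have key : (univ.filter fun b : K =>
        b ^ p - c ^ (p - 1) * b - aeval x P * c ^ (p - 1) = 0) =
        (univ.filter fun z : K => (z ^ p - z) * c = aeval x P).image fun z => c * z := by
      ext b
      simp only [Finset.mem_filter, Finset.mem_univ, true_and, Finset.mem_image]
      constructor
      · intro hb
        refine ⟨b / c, ?_, mul_div_cancel₀ b hQx⟩
        have hid := hident (b / c)
        rw [mul_div_cancel₀ b hQx, hb] at hid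
        have := (mul_eq_zero.1 hid.symm).resolve_left (pow_ne_zero _ hQx)
        exact sub_eq_zero.1 this
      · rintro ⟨z, hz, rfl⟩
        rw [hident z, hz, sub_self, mul_zero]
    rw [key, Finset.card_image_of_injective _ (mul_right_injective₀ hQx), hfilt]

omit [Fintype K] in
/-- `𝔽_p ⊆ E` forces characteristic `p`. [folklore] -/
theorem charP_of_algebra_zmod : CharP K p :=
  (RingHom.charP_iff_charP (algebraMap (ZMod p) K) p).1 inferInstance

/-- **Hasse–Weil input for Weil's bound on rational exponential sums.** Let `P, Q ∈ 𝔽_p[X]` be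
coprime with `deg P, deg Q ≤ k`, `1 ≤ deg Q < p`, and let `c₀ ∈ 𝔽_p` with `P(c₀) = 0 ≠ Q(c₀)`.
Then for every finite extension `E/𝔽_p` and every primitive additive character `ψ₀` of `𝔽_p`,
`|Σ_{β ≠ 0} S_E(ψ₀^β)| ≤ (p-1)(kp-2) √#E + p(k+1) + 1`, where
`S_E(ψ) = Σ_{x ∈ E, Q(x) ≠ 0} ψ(Tr_{E/𝔽_p}(P(x)/Q(x)))`: the left side is `N - #E` for the number
`N` of `E`-points of the plane model of `zᵖ - z = P/Q`, and `|N - (#E + 1)|` is bounded by Weil's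
theorem for that curve (`abs_card_zeros_asPlaneModel_sub_le`). [cite: Weil1948]
[cite: Schmidt1976, Ch. II §11] -/
theorem norm_sum_extSum_mulShift_le {ψ₀ : AddChar (ZMod p) ℂ} (hψ₀ : ψ₀.IsPrimitive)
    {P Q : (ZMod p)[X]} {k : ℕ} (hP : P.natDegree ≤ k) (hQ : Q.natDegree ≤ k)
    (hPQ : IsCoprime P Q) (hQ1 : 1 ≤ Q.natDegree) (hQp : Q.natDegree < p) {c₀ : ZMod p}
    (hPc : P.eval c₀ = 0) (hQc : Q.eval c₀ ≠ 0) :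
    ‖∑ β ∈ univ.erase (0 : ZMod p), extSum (ψ₀.mulShift β) P Q K‖ ≤
      ((p - 1) * (k * p - 2) : ℕ) * √(Fintype.card K : ℝ) + (p * (k + 1) + 1 : ℕ) := by
  classical
  haveI : CharP K p := charP_of_algebra_zmod K
  set ι := algebraMap (ZMod p) K with hι
  set P' := P.map ι with hP'
  set Q' := Q.map ι with hQ'
  -- Weil's bound for the plane model over `K`
  have hW := abs_card_zeros_asPlaneModel_sub_le (K := K) (p := p) (P := P') (Q := Q') (k := k)
    (by rwa [hP', natDegree_map]) (by rwa [hQ', natDegree_map]) (hPQ.map (mapRingHom ι))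
    (by rwa [hQ', natDegree_map]) (by rwa [hQ', natDegree_map]) (c₀ := ι c₀)
    (by rw [hP', eval_map, eval₂_hom, hPc, map_zero])
    (by rw [hQ', eval_map, eval₂_hom]; exact (map_ne_zero ι).2 hQc)
  -- the sum over `β ≠ 0` is `N - #K`
  set N := (univ.filter fun ab : K × K => (asPlaneModel p P' Q').evalEval ab.1 ab.2 = 0).card
    with hN
  set A := (univ.filter fun xz : K × K =>
    aeval xz.1 Q ≠ 0 ∧ xz.2 ^ p - xz.2 = aeval xz.1 P / aeval xz.1 Q).card with hA
  set Z := (univ.filter fun x : K => aeval x Q = 0).card with hZ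
  set G := (univ.filter fun x : K => aeval x Q ≠ 0).card with hG
  have hNAZ : N = A + Z := card_zeros_asPlaneModel_eq K P Q
  have hGZ : G + Z = Fintype.card K := by
    rw [hG, hZ, Finset.card_filter, Finset.card_filter, ← Finset.sum_add_distrib,
      ← Finset.card_univ, Finset.card_eq_sum_ones]
    refine Finset.sum_congr rfl fun x _ => ?_
    by_cases h : aeval x Q = 0 <;> simp [h]
  have hsum : ∑ β ∈ univ.erase (0 : ZMod p), extSum (ψ₀.mulShift β) P Q K =
      (N : ℂ) - Fintype.card K := by
    have h := Finset.sum_erase_add univ (fun β => extSum (ψ₀.mulShift β) P Q K)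
      (Finset.mem_univ (0 : ZMod p))
    rw [sum_extSum_mulShift_eq_card K hψ₀, extSum_mulShift_zero] at h
    rw [← hA, ← hG] at h
    have h' : ∑ β ∈ univ.erase (0 : ZMod p), extSum (ψ₀.mulShift β) P Q K = (A : ℂ) - G := by
      rw [← h]; ring
    rw [h', hNAZ, ← hGZ]
    push_cast
    ring
  rw [hsum]
  have hnorm : ‖((N : ℂ) - Fintype.card K)‖ = |(N : ℝ) - Fintype.card K| := by
    rw [← Complex.ofReal_natCast, ← Complex.ofReal_natCast, ← Complex.ofReal_sub,
      Complex.norm_real, Real.norm_eq_abs]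
  rw [hnorm]
  have h1 : |(N : ℝ) - Fintype.card K| ≤ |(N : ℝ) - (Fintype.card K + 1)| + 1 := by
    have := abs_sub_abs_le_abs_sub ((N : ℝ) - Fintype.card K) ((N : ℝ) - (Fintype.card K + 1))
    rw [show (N : ℝ) - Fintype.card K - ((N : ℝ) - (Fintype.card K + 1)) = 1 by ring,
      abs_one] at this
    linarith
  refine h1.trans ?_
  push_cast at hW ⊢
  linarith

end HasseWeil

/-! ## §B. The dichotomy resolved: Weil's bound in normalised form -/

open HybridLFunction (IsMonicMul lsumOf psumOf)
open UniqueFactorizationMonoid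

/-! ### §B1. Additivity of `t_n = tFn n 1` in the degree; the bad case on the ground field -/

section Ground

variable {F : Type*} [Field F] [Fintype F] [DecidableEq F]

/-- **`t_{n₁+n₂} = t_{n₁} + t_{n₂}`** for `n₁, n₂ ≥ μ` (`tFn_add` with `ρ₁ = ρ₂ = 1`).
[cite: Schmidt1976, Ch. II §9, Lemma 9A] -/
theorem tFn_one_add {P Q : F[X]} (hQ0 : Q ≠ 0) (hQ1 : 1 ≤ Q.natDegree)
    (hPQ : P.natDegree ≤ Q.natDegree) {n₁ n₂ : ℕ} (hn₁ : (modulusSq Q).natDegree ≤ n₁)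
    (hn₂ : (modulusSq Q).natDegree ≤ n₂) :
    tFn P Q (n₁ + n₂) 1 = tFn P Q n₁ 1 + tFn P Q n₂ 1 := by
  have h1deg := degree_one_lt_natDegree_modulusSq hQ0 hQ1
  have h := tFn_add hQ0 hPQ hn₁ hn₂ h1deg h1deg isCoprime_one_left isCoprime_one_left
  rwa [mul_one, modByMonic_eq_self_of_degree_lt hQ0 h1deg] at h

/-- **`t_{j d} = j · t_d`** for `d ≥ μ`, `j ≥ 1`. [cite: Schmidt1976, Ch. II §9, Lemma 9A] -/
theorem tFn_one_mul {P Q : F[X]} (hQ0 : Q ≠ 0) (hQ1 : 1 ≤ Q.natDegree)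
    (hPQ : P.natDegree ≤ Q.natDegree) {d : ℕ} (hd : (modulusSq Q).natDegree ≤ d) {j : ℕ}
    (hj : 1 ≤ j) : tFn P Q (j * d) 1 = j • tFn P Q d 1 := by
  induction j, hj using Nat.le_induction with
  | base => rw [one_mul, one_smul]
  | succ j hj ih =>
    rw [add_mul, one_mul, tFn_one_add hQ0 hQ1 hPQ (hd.trans (Nat.le_mul_of_pos_left d hj)) hd, ih,
      succ_nsmul]

/-- **The bad case on `F`**: if `D ≡ 0` on the residues then `traceFn h = t_{deg h}` for every monic
`h` of degree `≥ μ` coprime to `Q`. [cite: Schmidt1976, Ch. II §9] -/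
theorem traceFn_eq_tFn_one_of_D_eq_zero {P Q : F[X]} (hQ0 : Q ≠ 0) (hQ1 : 1 ≤ Q.natDegree)
    (hPQ : P.natDegree ≤ Q.natDegree) (hbad : ∀ ρ ∈ residues Q, D P Q ρ = 0) {h : F[X]}
    (hm : h.Monic) (hn : (modulusSq Q).natDegree ≤ h.natDegree) (hc : IsCoprime h Q) :
    traceFn P Q h = tFn P Q h.natDegree 1 := by
  have hM := monic_modulusSq hQ0
  have hρdeg : (h %ₘ modulusSq Q).degree < (modulusSq Q).natDegree := by
    rw [← degree_eq_natDegree hM.ne_zero]; exact degree_modByMonic_lt _ hM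
  have hρc : IsCoprime (h %ₘ modulusSq Q) Q := by
    have : h %ₘ modulusSq Q = h + (-(h /ₘ modulusSq Q)) * modulusSq Q := by
      rw [modByMonic_eq_sub_mul_div h (modulusSq Q)]; ring
    rw [this, isCoprime_add_mul_modulusSq_iff Q]
    exact hc
  rw [traceFn_eq_tFn hQ0 hPQ hm rfl hn hc, tFn_eq hQ0 hQ1 hPQ hn hρdeg hρc,
    hbad _ (mem_residues.mpr ⟨hρdeg, hρc⟩), add_zero]

omit [Fintype F] in
/-- On a monic irreducible `π`, `traceFn π = traceTerm π`. [folklore] -/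
theorem traceFn_of_irreducible (P Q : F[X]) {π : F[X]} (hm : π.Monic) (hirr : Irreducible π) :
    traceFn P Q π = traceTerm P Q π := by
  unfold traceFn
  rw [normalizedFactors_irreducible hirr, hm.normalize_eq_self, Multiset.map_singleton,
    Multiset.sum_singleton]

end Ground

/-! ### §B2. The bad case in an extension: traces vanish outside small subfields -/

section Extension

variable {p : ℕ} [Fact p.Prime]
variable {E : Type*} [Field E] [Fintype E] [Algebra (ZMod p) E]

/-- **Bad case ⇒ vanishing traces**: if `D ≡ 0` and `p μ ∣ [E : 𝔽_p]`, then
`Tr_{E/𝔽_p}(P(x)/Q(x)) = 0` for every `x ∈ E` with `Q(x) ≠ 0` whose minimal polynomial has degree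
`≥ μ`: by (10.5) the trace is `([E:𝔽_p]/d) · t_d = t_{[E:𝔽_p]} = (pM) · t_μ = 0`.
[cite: Schmidt1976, Ch. II §10, (10.5)] -/
theorem trace_div_eq_zero_of_bad {P Q : (ZMod p)[X]} (hQ0 : Q ≠ 0) (hQ1 : 1 ≤ Q.natDegree)
    (hPQ : P.natDegree ≤ Q.natDegree) (hbad : ∀ ρ ∈ residues Q, D P Q ρ = 0)
    (hν : p * (modulusSq Q).natDegree ∣ Module.finrank (ZMod p) E) {x : E} (hQx : aeval x Q ≠ 0)
    (hdeg : (modulusSq Q).natDegree ≤ (minpoly (ZMod p) x).natDegree) :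
    Algebra.trace (ZMod p) E (aeval x P / aeval x Q) = 0 := by
  classical
  set μ := (modulusSq Q).natDegree with hμ
  have hint : IsIntegral (ZMod p) x := .of_finite (ZMod p) x
  have hπm : (minpoly (ZMod p) x).Monic := minpoly.monic hint
  have hπi : Irreducible (minpoly (ZMod p) x) := minpoly.irreducible hint
  have hπQ : ¬ minpoly (ZMod p) x ∣ Q := fun h => hQx ((aeval_eq_zero_iff_minpoly_dvd Q x).2 h)
  have hcop : IsCoprime (minpoly (ZMod p) x) Q := (hπi.coprime_iff_not_dvd).2 hπQ
  rw [trace_div_eq, ← traceFn_of_irreducible P Q hπm hπi,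
    traceFn_eq_tFn_one_of_D_eq_zero hQ0 hQ1 hPQ hbad hπm hdeg hcop]
  -- `[E : 𝔽_p(x)] · t_d = t_{[E : 𝔽_p]}`
  set j := Module.finrank (ZMod p)⟮x⟯ E with hj
  have hj1 : 1 ≤ j := Module.finrank_pos
  have hjd : j * (minpoly (ZMod p) x).natDegree = Module.finrank (ZMod p) E := by
    rw [mul_comm]; exact KloostermanLFunction.natDegree_minpoly_mul_finrank x
  rw [← tFn_one_mul hQ0 hQ1 hPQ hdeg hj1, hjd]
  -- `t_{p μ M} = (p M) · t_μ = 0`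
  obtain ⟨M, hM⟩ := hν
  have hM1 : 1 ≤ p * M := by
    rcases Nat.eq_zero_or_pos M with rfl | hMpos
    · exfalso
      have : Module.finrank (ZMod p) E = 0 := by rw [hM, mul_zero]
      exact Module.finrank_pos.ne' this
    · exact Nat.one_le_iff_ne_zero.2 (Nat.mul_ne_zero (Fact.out : p.Prime).ne_zero hMpos.ne')
  rw [hM, show p * μ * M = (p * M) * μ by ring, tFn_one_mul hQ0 hQ1 hPQ le_rfl hM1, nsmul_eq_mul,
    Nat.cast_mul, ZMod.natCast_self, zero_mul, zero_mul]

/-- An element of a finite extension of `𝔽_p` with minimal polynomial of degree `d` lies in the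
subfield with `p^d` elements: `x^{p^d} = x`. [folklore] -/
theorem pow_pow_natDegree_minpoly (x : E) : x ^ p ^ (minpoly (ZMod p) x).natDegree = x := by
  classical
  have hint : IsIntegral (ZMod p) x := .of_finite (ZMod p) x
  set K := (ZMod p)⟮x⟯ with hK
  haveI : FiniteDimensional (ZMod p) K := IntermediateField.adjoin.finiteDimensional hint
  letI : Fintype K := Fintype.ofFinite K
  have hcard : Fintype.card K = p ^ (minpoly (ZMod p) x).natDegree := by
    rw [Module.card_eq_pow_finrank (K := ZMod p) (V := K), ZMod.card,
      IntermediateField.adjoin.finrank hint]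
  have h := FiniteField.pow_card (IntermediateField.AdjoinSimple.gen (ZMod p) x)
  rw [hcard] at h
  have h' := congrArg (algebraMap K E) h
  rwa [map_pow, IntermediateField.AdjoinSimple.algebraMap_gen] at h'

/-- **Few elements in small subfields**: `#{x ∈ E : deg (minpoly x) < μ} < p^μ`. [folklore] -/
theorem card_filter_natDegree_minpoly_lt (μ : ℕ) :
    (univ.filter fun x : E => (minpoly (ZMod p) x).natDegree < μ).card < p ^ μ := by
  classical
  have hp : p.Prime := Fact.out
  have hsub : (univ.filter fun x : E => (minpoly (ZMod p) x).natDegree < μ) ⊆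
      (Finset.Ico 1 μ).biUnion fun d => univ.filter fun x : E => x ^ p ^ d = x := by
    intro x hx
    rw [Finset.mem_filter] at hx
    rw [Finset.mem_biUnion]
    refine ⟨(minpoly (ZMod p) x).natDegree, ?_, ?_⟩
    · rw [Finset.mem_Ico]
      exact ⟨Nat.one_le_iff_ne_zero.2 (minpoly.natDegree_pos (.of_finite (ZMod p) x)).ne', hx.2⟩
    · rw [Finset.mem_filter]
      exact ⟨Finset.mem_univ _, pow_pow_natDegree_minpoly x⟩
  refine (Finset.card_le_card hsub).trans_lt ((Finset.card_biUnion_le).trans_lt ?_)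
  have hle : ∀ d ∈ Finset.Ico 1 μ, (univ.filter fun x : E => x ^ p ^ d = x).card ≤ p ^ d := by
    intro d hd
    rw [Finset.mem_Ico] at hd
    have h1 : 1 < p ^ d := Nat.one_lt_pow (by omega) hp.one_lt
    set f : E[X] := X ^ p ^ d - X with hf
    have hf0 : f ≠ 0 := FiniteField.X_pow_card_pow_sub_X_ne_zero E (by omega) hp.one_lt
    have hdeg : f.natDegree = p ^ d := FiniteField.X_pow_card_pow_sub_X_natDegree_eq E (by omega) hp.one_lt
    refine (Polynomial.card_le_degree_of_subset_roots fun x hx => ?_).trans_eq hdeg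
    rw [Finset.mem_val, Finset.mem_filter] at hx
    rw [mem_roots hf0, IsRoot.def, hf, eval_sub, eval_pow, eval_X, hx.2, sub_self]
  calc ∑ d ∈ Finset.Ico 1 μ, (univ.filter fun x : E => x ^ p ^ d = x).card
      ≤ ∑ d ∈ Finset.Ico 1 μ, p ^ d := Finset.sum_le_sum hle
    _ < p ^ μ := Nat.geomSum_lt hp.two_le fun d hd => (Finset.mem_Ico.1 hd).2

omit [Fintype E] in
/-- `#{x ∈ E : Q(x) = 0} ≤ deg Q` for `Q ≠ 0`. [folklore] -/
theorem card_filter_aeval_eq_zero_le [Fintype E] {Q : (ZMod p)[X]} (hQ0 : Q ≠ 0) :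
    (univ.filter fun x : E => aeval x Q = 0).card ≤ Q.natDegree := by
  classical
  have hQ' : Q.map (algebraMap (ZMod p) E) ≠ 0 := Polynomial.map_ne_zero hQ0
  rw [← Polynomial.natDegree_map (algebraMap (ZMod p) E)]
  apply Polynomial.card_le_degree_of_subset_roots
  intro x hx
  rw [Finset.mem_val, Finset.mem_filter] at hx
  rw [mem_roots hQ', IsRoot.def, eval_map, ← aeval_def]
  exact hx.2

/-- **Lower bound in the bad case**: for any additive character `χ` of `𝔽_p`,
`Re S_E(χ) ≥ #E − deg Q − 2 p^μ` when `D ≡ 0` and `p μ ∣ [E : 𝔽_p]`. [folklore] -/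
theorem re_extSum_ge_of_bad {P Q : (ZMod p)[X]} (hQ0 : Q ≠ 0) (hQ1 : 1 ≤ Q.natDegree)
    (hPQ : P.natDegree ≤ Q.natDegree) (hbad : ∀ ρ ∈ residues Q, D P Q ρ = 0)
    (hν : p * (modulusSq Q).natDegree ∣ Module.finrank (ZMod p) E) (χ : AddChar (ZMod p) ℂ) :
    (Fintype.card E : ℝ) - Q.natDegree - 2 * (p : ℝ) ^ (modulusSq Q).natDegree ≤
      (extSum χ P Q E).re := by
  classical
  set μ := (modulusSq Q).natDegree with hμ
  set good := univ.filter fun x : E => aeval x Q ≠ 0 with hgood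
  set small := univ.filter fun x : E => (minpoly (ZMod p) x).natDegree < μ with hsmall
  have hsmallc : (small.card : ℝ) < (p : ℝ) ^ μ := by
    exact_mod_cast card_filter_natDegree_minpoly_lt (E := E) μ
  have hzero : ((univ.filter fun x : E => aeval x Q = 0).card : ℝ) ≤ Q.natDegree := by
    exact_mod_cast card_filter_aeval_eq_zero_le (E := E) hQ0
  have hgoodc : (Fintype.card E : ℝ) - Q.natDegree ≤ good.card := by
    have h := Finset.card_filter_add_card_filter_not (s := (univ : Finset E))
      (fun x : E => aeval x Q = 0)
    rw [Finset.card_univ] at h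
    have h' : (good.card : ℝ) = Fintype.card E - (univ.filter fun x : E => aeval x Q = 0).card := by
      rw [hgood]
      have : ((univ.filter fun x : E => ¬ aeval x Q = 0).card : ℝ) =
          Fintype.card E - (univ.filter fun x : E => aeval x Q = 0).card := by
        rw [← h]; push_cast; ring
      exact this
    linarith
  -- split the sum over `good` into `good \ small` (trace `0`, value `1`) and `good ∩ small`
  rw [extSum_eq E χ P Q, ← Finset.sum_filter_add_sum_filter_not good (fun x => x ∈ small),
    Complex.add_re, Complex.re_sum, Complex.re_sum]
  have hbig : ∀ x ∈ good.filter (fun x => x ∉ small),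
      (χ (Algebra.trace (ZMod p) E (aeval x P / aeval x Q))).re = 1 := by
    intro x hx
    simp only [Finset.mem_filter, hgood, hsmall, Finset.mem_univ, true_and, not_lt] at hx
    rw [trace_div_eq_zero_of_bad hQ0 hQ1 hPQ hbad hν hx.1 hx.2, AddChar.map_zero_eq_one,
      Complex.one_re]
  rw [Finset.sum_congr rfl hbig, Finset.sum_const, nsmul_eq_mul, mul_one]
  have hsm : -(small.card : ℝ) ≤ ∑ x ∈ good.filter (fun x => x ∈ small),
      (χ (Algebra.trace (ZMod p) E (aeval x P / aeval x Q))).re := by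
    have h1 : ∀ x ∈ good.filter (fun x => x ∈ small),
        (-1 : ℝ) ≤ (χ (Algebra.trace (ZMod p) E (aeval x P / aeval x Q))).re := fun x _ =>
      (abs_le.1 ((Complex.abs_re_le_norm _).trans (AddChar.norm_apply χ _).le)).1
    have h2 := Finset.card_nsmul_le_sum _ _ (-1 : ℝ) h1
    rw [nsmul_eq_mul, mul_neg, mul_one] at h2
    refine le_trans ?_ h2
    have : (good.filter (fun x => x ∈ small)).card ≤ small.card :=
      Finset.card_le_card fun x hx => (Finset.mem_filter.1 hx).2
    have : ((good.filter (fun x => x ∈ small)).card : ℝ) ≤ small.card := by exact_mod_cast this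
    linarith
  have hbigc : (good.card : ℝ) - small.card ≤ (good.filter (fun x => x ∉ small)).card := by
    have h := Finset.card_filter_add_card_filter_not (s := good) (fun x => x ∈ small)
    have : (good.filter (fun x => x ∈ small)).card ≤ small.card :=
      Finset.card_le_card fun x hx => (Finset.mem_filter.1 hx).2
    have e : ((good.filter (fun x => x ∉ small)).card : ℝ) =
        good.card - (good.filter (fun x => x ∈ small)).card := by
      rw [← h]; push_cast; ring
    rw [e]
    have : ((good.filter (fun x => x ∈ small)).card : ℝ) ≤ small.card := by exact_mod_cast this
    linarith
  linarith

end Extension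

/-! ### §B3. The bad case contradicts the Hasse–Weil bound -/

section Main

variable {p : ℕ} [Fact p.Prime]

omit [Fact p.Prime] in
/-- `√(p^{2m}) = p^m`. [folklore] -/
theorem sqrt_pow_two_mul (m : ℕ) : √((p : ℝ) ^ (2 * m)) = (p : ℝ) ^ m := by
  rw [mul_comm, pow_mul]
  exact Real.sqrt_sq (pow_nonneg (Nat.cast_nonneg p) m)

/-- **The bad case does not occur** under the hypotheses of Weil's theorem (coprime `P, Q`,
`deg P ≤ deg Q`, `1 ≤ deg Q < p`, a rational zero of `P` off the poles): with `ν = 2pμC` the lower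
bound `Re Σ_{β≠0} S_E(ψ_β) ≥ (p−1)(p^ν − deg Q − 2p^μ)` of the bad case (`re_extSum_ge_of_bad`)
contradicts the Hasse–Weil bound `|Σ_{β≠0} S_E(ψ_β)| ≤ c₁ p^{ν/2} + c₂`
(`norm_sum_extSum_mulShift_le`) once `p^{ν/2} > C = c₁ + c₂ + deg Q + 2p^μ`.
[cite: Schmidt1976, Ch. II §11] [cite: Weil1948] -/
theorem not_bad {ψ : AddChar (ZMod p) ℂ} (hψ : ψ.IsPrimitive) {P Q : (ZMod p)[X]}
    (hPQ : P.natDegree ≤ Q.natDegree) (hQ1 : 1 ≤ Q.natDegree) (hQp : Q.natDegree < p)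
    (hcop : IsCoprime P Q) {c₀ : ZMod p} (hPc : P.eval c₀ = 0) (hQc : Q.eval c₀ ≠ 0) :
    ¬ ∀ ρ ∈ residues Q, D P Q ρ = 0 := by
  classical
  intro hbad
  have hp : p.Prime := Fact.out
  have hQ0 : Q ≠ 0 := by rintro rfl; simp at hQ1
  set k := Q.natDegree with hk
  set μ := (modulusSq Q).natDegree with hμ
  -- the constants and the exponent
  set c₁ : ℕ := (p - 1) * (k * p - 2) with hc₁
  set c₂ : ℕ := p * (k + 1) + 1 with hc₂
  set C : ℕ := c₁ + c₂ + k + 2 * p ^ μ with hC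
  set m : ℕ := p * μ * C with hm
  set ν : ℕ := 2 * m with hν
  have hC1 : 1 ≤ C := by
    have : 1 ≤ p ^ μ := Nat.one_le_pow _ _ hp.pos
    omega
  have hμ1 : 1 ≤ μ := by rw [hμ, natDegree_modulusSq hQ0]; omega
  have hm1 : C ≤ m := by
    rw [hm]
    calc C = 1 * 1 * C := by ring
      _ ≤ p * μ * C := by gcongr; omega
  have hν0 : ν ≠ 0 := by omega
  letI : Fintype (GaloisField p ν) := Fintype.ofFinite _
  have hcard : Fintype.card (GaloisField p ν) = p ^ ν := by
    rw [← Nat.card_eq_fintype_card, GaloisField.card p ν hν0]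
  have hrank : Module.finrank (ZMod p) (GaloisField p ν) = ν := GaloisField.finrank p hν0
  -- Hasse–Weil upper bound
  have hup := norm_sum_extSum_mulShift_le (GaloisField p ν) hψ hPQ le_rfl hcop hQ1 hQp hPc hQc
  rw [hcard] at hup
  -- bad-case lower bound
  have hdvd : p * μ ∣ Module.finrank (ZMod p) (GaloisField p ν) := by
    rw [hrank, hν, hm]
    exact ⟨2 * C, by ring⟩
  have hlow : ∀ β : ZMod p, (p : ℝ) ^ ν - k - 2 * (p : ℝ) ^ μ ≤
      (extSum (ψ.mulShift β) P Q (GaloisField p ν)).re := fun β => by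
    have := re_extSum_ge_of_bad (E := GaloisField p ν) hQ0 hQ1 hPQ hbad hdvd (ψ.mulShift β)
    rw [hcard] at this
    push_cast at this
    exact this
  have hre : ((p - 1 : ℕ) : ℝ) * ((p : ℝ) ^ ν - k - 2 * (p : ℝ) ^ μ) ≤
      ‖∑ β ∈ univ.erase (0 : ZMod p), extSum (ψ.mulShift β) P Q (GaloisField p ν)‖ := by
    refine le_trans ?_ (Complex.re_le_norm _)
    rw [Complex.re_sum]
    have h := Finset.card_nsmul_le_sum (univ.erase (0 : ZMod p))
      (fun β => (extSum (ψ.mulShift β) P Q (GaloisField p ν)).re) _ (fun β _ => hlow β)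
    rw [Finset.card_erase_of_mem (Finset.mem_univ _), Finset.card_univ, ZMod.card,
      nsmul_eq_mul] at h
    exact h
  -- `X = p^m`
  set X : ℝ := (p : ℝ) ^ m with hX
  have hp2 : (2 : ℝ) ≤ p := by exact_mod_cast hp.two_le
  have hX1 : 1 ≤ X := one_le_pow₀ (by linarith)
  have hXν : (p : ℝ) ^ ν = X ^ 2 := by rw [hν, mul_comm, pow_mul]
  have hsqrt : √(((p ^ ν : ℕ) : ℝ)) = X := by push_cast; rw [hν]; exact sqrt_pow_two_mul m
  rw [hsqrt] at hup
  rw [hXν] at hre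
  have key := hre.trans hup
  -- divide by `p - 1 ≥ 1`
  have hp1 : (1 : ℝ) ≤ ((p - 1 : ℕ) : ℝ) := by
    have : 1 ≤ p - 1 := by have := hp.two_le; omega
    exact_mod_cast this
  have hc₁0 : (0 : ℝ) ≤ (c₁ : ℕ) := Nat.cast_nonneg _
  have hc₂0 : (0 : ℝ) ≤ (c₂ : ℕ) := Nat.cast_nonneg _
  have key2 : X ^ 2 - k - 2 * (p : ℝ) ^ μ ≤ (c₁ : ℕ) * X + (c₂ : ℕ) := by
    by_cases h : X ^ 2 - k - 2 * (p : ℝ) ^ μ ≤ 0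
    · nlinarith
    · push Not at h
      nlinarith
  -- hence `X ≤ C`
  have hCe : (C : ℝ) = (c₁ : ℕ) + (c₂ : ℕ) + k + 2 * (p : ℝ) ^ μ := by
    rw [hC]; push_cast; ring
  have key3 : X ≤ C := by
    rw [hCe]
    have hk0 : (0 : ℝ) ≤ k := Nat.cast_nonneg _
    have hpμ : (0 : ℝ) ≤ 2 * (p : ℝ) ^ μ := by positivity
    -- `X² ≤ (c₁ + c₂ + k + 2p^μ) X` since `X ≥ 1`
    have : X ^ 2 ≤ ((c₁ : ℕ) + (c₂ : ℕ) + k + 2 * (p : ℝ) ^ μ) * X := by nlinarith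
    nlinarith
  -- but `X = p^m > m ≥ C`
  have hlt : (C : ℝ) < X := by
    have h2 : m < p ^ m := Nat.lt_pow_self hp.one_lt
    calc (C : ℝ) ≤ m := by exact_mod_cast hm1
      _ < ((p ^ m : ℕ) : ℝ) := by exact_mod_cast h2
      _ = X := by push_cast; rfl
  linarith

/-! ### §B4. The good case: power sums and Schmidt's Lemma 6A -/

/-- **The good case**: if `D ρ₀ ≠ 0` for some residue, then `|S(ψ)| ≤ (μ − 1) √p` for every
primitive `ψ`: the `L`-functions of all twists `ψ_β` (`β ≠ 0`) are polynomials of degree `≤ μ − 1`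
(`lsumOf_lam_eq_zero`), `S_E(ψ_β) = −Σ_i ω_{β,i}^{[E:𝔽_p]}`, the Hasse–Weil bound over `𝔽_{p^ν}`
controls the power sums of all `ω_{β,i}` and Lemma 6A gives `|ω_{β,i}| ≤ √p`.
[cite: Schmidt1976, Ch. II §6 Lemma 6A, §10 Corollary 10D, §11] [cite: Weil1948] -/
theorem norm_extSum_le_of_good {ψ : AddChar (ZMod p) ℂ} (hψ : ψ.IsPrimitive) {P Q : (ZMod p)[X]}
    (hPQ : P.natDegree ≤ Q.natDegree) (hQ1 : 1 ≤ Q.natDegree) (hQp : Q.natDegree < p)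
    (hcop : IsCoprime P Q) {c₀ : ZMod p} (hPc : P.eval c₀ = 0) (hQc : Q.eval c₀ ≠ 0)
    (hgood : ∃ ρ₀ ∈ residues Q, D P Q ρ₀ ≠ 0) :
    ‖extSum ψ P Q (ZMod p)‖ ≤ ((modulusSq Q).natDegree - 1 : ℕ) * √(p : ℝ) := by
  classical
  have hp : p.Prime := Fact.out
  have hQ0 : Q ≠ 0 := by rintro rfl; simp at hQ1
  set k := Q.natDegree with hk
  set μ := (modulusSq Q).natDegree with hμ
  have hμ1 : 1 ≤ μ := by rw [hμ, natDegree_modulusSq hQ0]; omega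
  set ℓ : ℕ := μ - 1 with hℓ
  obtain ⟨ρ₀, hρ₀, hD⟩ := hgood
  -- vanishing of the `L`-coefficients of every twist
  have hvan : ∀ β : ZMod p, β ≠ 0 → ∀ n, ℓ + 1 ≤ n → lsumOf (lam (ψ.mulShift β) P Q) n = 0 := by
    intro β hβ n hn
    refine lsumOf_lam_eq_zero (ψ.mulShift β) hQ0 hQ1 hPQ ⟨ρ₀, hρ₀, fun h1 => hD ?_⟩ n (by omega)
    rw [AddChar.mulShift_apply, hψ.zmod_char_eq_one_iff p] at h1
    exact (mul_eq_zero.1 h1).resolve_left hβ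
  have hex : ∀ β : {β : ZMod p // β ≠ 0}, ∃ ω : Fin ℓ → ℂ,
      ∀ (E : Type) [Field E] [Fintype E] [Algebra (ZMod p) E],
        extSum (ψ.mulShift β.1) P Q E = -∑ i, ω i ^ Module.finrank (ZMod p) E :=
    fun β => exists_extSum_eq_neg_powerSum (ψ.mulShift β.1) P Q (hvan β.1 β.2)
  choose ω hω using hex
  set c₁ : ℕ := (p - 1) * (k * p - 2) with hc₁
  set c₂ : ℕ := p * (k + 1) + 1 with hc₂
  set s : Finset ({β : ZMod p // β ≠ 0} × Fin ℓ) := univ with hs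
  set Ω : {β : ZMod p // β ≠ 0} × Fin ℓ → ℂ := fun bi => ω bi.1 bi.2 with hΩ
  -- the power sums of the `ω_{β,i}` are `−Σ_{β ≠ 0} S_{𝔽_{p^ν}}(ψ_β)`
  have hpow : ∀ ν : ℕ, 1 ≤ ν → ‖∑ bi ∈ s, Ω bi ^ ν‖ ≤ ((c₁ : ℕ) + (c₂ : ℕ) : ℝ) * √(p : ℝ) ^ ν := by
    intro ν hν
    have hν0 : ν ≠ 0 := by omega
    letI : Fintype (GaloisField p ν) := Fintype.ofFinite _
    have hcard : Fintype.card (GaloisField p ν) = p ^ ν := by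
      rw [← Nat.card_eq_fintype_card, GaloisField.card p ν hν0]
    have hrank : Module.finrank (ZMod p) (GaloisField p ν) = ν := GaloisField.finrank p hν0
    have hsum : ∑ bi ∈ s, Ω bi ^ ν =
        -∑ β ∈ univ.erase (0 : ZMod p), extSum (ψ.mulShift β) P Q (GaloisField p ν) := by
      rw [Finset.sum_subtype (univ.erase (0 : ZMod p)) (p := fun β : ZMod p => β ≠ 0)
        (fun β => by simp) (fun β => extSum (ψ.mulShift β) P Q (GaloisField p ν))]
      rw [hs, Fintype.sum_prod_type, ← Finset.sum_neg_distrib]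
      refine Finset.sum_congr rfl fun β _ => ?_
      rw [hω β (GaloisField p ν), hrank, neg_neg]
    rw [hsum, norm_neg]
    have hb := norm_sum_extSum_mulShift_le (GaloisField p ν) hψ hPQ le_rfl hcop hQ1 hQp hPc hQc
    rw [hcard] at hb
    have hsq : √(((p ^ ν : ℕ) : ℝ)) = √(p : ℝ) ^ ν := by
      push_cast
      rw [← Real.sqrt_sq (pow_nonneg (Real.sqrt_nonneg (p : ℝ)) ν), ← pow_mul, mul_comm, pow_mul,
        Real.sq_sqrt (Nat.cast_nonneg p)]
    rw [hsq] at hb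
    refine hb.trans ?_
    have h1 : (1 : ℝ) ≤ √(p : ℝ) ^ ν :=
      one_le_pow₀ (Real.one_le_sqrt.2 (by exact_mod_cast hp.one_lt.le))
    have hc₂0 : (0 : ℝ) ≤ (c₂ : ℕ) := Nat.cast_nonneg _
    nlinarith
  have hroots := norm_le_of_norm_powerSum_le s Ω (Real.sqrt_pos.2 (by exact_mod_cast hp.pos)) 1
    hpow
  -- `S(ψ) = −Σ_i ω_{1,i}`
  have h1 : extSum ψ P Q (ZMod p) = -∑ i, ω ⟨1, one_ne_zero⟩ i := by
    have h := hω ⟨1, one_ne_zero⟩ (ZMod p)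
    rw [Module.finrank_self] at h
    simp only [pow_one, AddChar.mulShift_one] at h
    exact h
  rw [h1, norm_neg]
  calc ‖∑ i, ω ⟨1, one_ne_zero⟩ i‖ ≤ ∑ i, ‖ω ⟨1, one_ne_zero⟩ i‖ := norm_sum_le _ _
    _ ≤ ∑ _i : Fin ℓ, √(p : ℝ) := Finset.sum_le_sum fun i _ =>
        hroots (⟨1, one_ne_zero⟩, i) (by rw [hs]; exact Finset.mem_univ _)
    _ = (ℓ : ℝ) * √(p : ℝ) := by
        rw [Finset.sum_const, Finset.card_univ, Fintype.card_fin, nsmul_eq_mul]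

/-! ### §B5. Weil's bound in normalised form -/

/-- **Weil's bound for exponential sums with a rational argument (Weil 1948; Schmidt, Ch. II
Theorem 2E for `f = P/Q`)**, in the normalised form used downstream: for a prime `p`, a primitive
additive character `ψ` of `𝔽_p`, and `P, Q ∈ 𝔽_p[X]` coprime with `deg P ≤ deg Q`, `1 ≤ deg Q < p`
and a zero `c₀ ∈ 𝔽_p` of `P` with `Q(c₀) ≠ 0`,
`|Σ_{x ∈ 𝔽_p, Q(x) ≠ 0} ψ(P(x)/Q(x))| ≤ (2 deg Q − 1) √p`.
PROVED (Stepanov–Schmidt method + Hasse–Weil for the Artin–Schreier function field).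
[cite: Weil1948] [cite: Schmidt1976, Ch. II §2 Theorem 2E and §11] -/
theorem norm_extSum_le_sqrt {ψ : AddChar (ZMod p) ℂ} (hψ : ψ.IsPrimitive) {P Q : (ZMod p)[X]}
    (hPQ : P.natDegree ≤ Q.natDegree) (hQ1 : 1 ≤ Q.natDegree) (hQp : Q.natDegree < p)
    (hcop : IsCoprime P Q) {c₀ : ZMod p} (hPc : P.eval c₀ = 0) (hQc : Q.eval c₀ ≠ 0) :
    ‖extSum ψ P Q (ZMod p)‖ ≤ (2 * Q.natDegree - 1 : ℕ) * √(p : ℝ) := by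
  have hQ0 : Q ≠ 0 := by rintro rfl; simp at hQ1
  rw [← natDegree_modulusSq hQ0]
  by_cases hbad : ∀ ρ ∈ residues Q, D P Q ρ = 0
  · exact absurd hbad (not_bad hψ hPQ hQ1 hQp hcop hPc hQc)
  · push Not at hbad
    obtain ⟨ρ₀, hρ₀, hD⟩ := hbad
    exact norm_extSum_le_of_good hψ hPQ hQ1 hQp hcop hPc hQc ⟨ρ₀, hρ₀, hD⟩

/-- The same bound for the plain sum `Σ_{x ∈ 𝔽_p, Q(x) ≠ 0} ψ(P(x)/Q(x))` (the trace of `𝔽_p/𝔽_p`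
is the identity). [cite: Weil1948] -/
theorem norm_sum_div_le {ψ : AddChar (ZMod p) ℂ} (hψ : ψ.IsPrimitive) {P Q : (ZMod p)[X]}
    (hPQ : P.natDegree ≤ Q.natDegree) (hQ1 : 1 ≤ Q.natDegree) (hQp : Q.natDegree < p)
    (hcop : IsCoprime P Q) {c₀ : ZMod p} (hPc : P.eval c₀ = 0) (hQc : Q.eval c₀ ≠ 0) :
    ‖∑ x ∈ univ.filter (fun x : ZMod p => Q.eval x ≠ 0), ψ (P.eval x / Q.eval x)‖ ≤
      (2 * Q.natDegree - 1 : ℕ) * √(p : ℝ) := by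
  classical
  have h := norm_extSum_le_sqrt hψ hPQ hQ1 hQp hcop hPc hQc
  rw [extSum_eq] at h
  simp only [Algebra.trace_self_apply, coe_aeval_eq_eval] at h
  exact h

end Main

/-! ## §C. General form -/

/-! ### §C1. Normalisations of `Σ_{Q(x) ≠ 0} ψ(P(x)/Q(x))` over a finite field -/

section Normalise

variable {F : Type*} [Field F] [Fintype F] [DecidableEq F]

omit [DecidableEq F] in
/-- `|Σ_{x ∈ s} ψ(u x)| ≤ #s`. [folklore] -/
theorem norm_sum_addChar_le_card (ψ : AddChar F ℂ) (s : Finset F) (u : F → F) :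
    ‖∑ x ∈ s, ψ (u x)‖ ≤ s.card := by
  refine (norm_sum_le _ _).trans ?_
  calc ∑ x ∈ s, ‖ψ (u x)‖ ≤ ∑ _x ∈ s, (1 : ℝ) := Finset.sum_le_sum fun x _ => (AddChar.norm_apply _ _).le
    _ = s.card := by simp

/-- `#{x : Q(x) = 0} ≤ deg Q` for `Q ≠ 0`. [folklore] -/
theorem card_filter_eval_eq_zero_le {Q : F[X]} (hQ0 : Q ≠ 0) :
    (univ.filter fun x : F => Q.eval x = 0).card ≤ Q.natDegree := by
  apply Polynomial.card_le_degree_of_subset_roots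
  intro x hx
  rw [Finset.mem_val, Finset.mem_filter] at hx
  exact (mem_roots hQ0).2 hx.2

/-- A non-zero polynomial of degree `< #F` has a non-root. [folklore] -/
theorem exists_eval_ne_zero {Q : F[X]} (hQ0 : Q ≠ 0) (hlt : Q.natDegree < Fintype.card F) :
    ∃ c : F, Q.eval c ≠ 0 := by
  by_contra h
  push Not at h
  have : (univ.filter fun x : F => Q.eval x = 0) = univ := by
    ext x; simp [h x]
  have hle := card_filter_eval_eq_zero_le hQ0
  rw [this, Finset.card_univ] at hle
  omega

/-- Two non-roots when `deg Q + 1 < #F`. [folklore] -/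
theorem exists_eval_ne_zero_ne {Q : F[X]} (hQ0 : Q ≠ 0) (hlt : Q.natDegree + 1 < Fintype.card F)
    (c : F) : ∃ c' : F, c' ≠ c ∧ Q.eval c' ≠ 0 := by
  by_contra h
  push Not at h
  have hsub : (univ : Finset F) ⊆ insert c (univ.filter fun x : F => Q.eval x = 0) := by
    intro x _
    by_cases hx : x = c
    · rw [hx]; exact Finset.mem_insert_self _ _
    · exact Finset.mem_insert_of_mem (Finset.mem_filter.2 ⟨Finset.mem_univ _, h x hx⟩)
  have h1 := Finset.card_le_card hsub
  have h2 := Finset.card_insert_le c (univ.filter fun x : F => Q.eval x = 0)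
  have h3 := card_filter_eval_eq_zero_le hQ0
  rw [Finset.card_univ] at h1
  omega

/-- **Removing a common factor**: `|Σ_{AQ ≠ 0} ψ(AP/AQ) − Σ_{Q ≠ 0} ψ(P/Q)| ≤ deg A` (`A ≠ 0`):
the two sums agree off the `≤ deg A` roots of `A`. [folklore] -/
theorem norm_sum_mul_sub_le (ψ : AddChar F ℂ) {A : F[X]} (hA : A ≠ 0) (P Q : F[X]) :
    ‖∑ x ∈ univ.filter (fun x : F => (A * Q).eval x ≠ 0), ψ ((A * P).eval x / (A * Q).eval x) -
        ∑ x ∈ univ.filter (fun x : F => Q.eval x ≠ 0), ψ (P.eval x / Q.eval x)‖ ≤ A.natDegree := by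
  set s := univ.filter (fun x : F => Q.eval x ≠ 0) with hs
  have hsplit := (Finset.sum_filter_add_sum_filter_not s (fun x => A.eval x ≠ 0)
    (fun x => ψ (P.eval x / Q.eval x))).symm
  have hfirst : ∑ x ∈ univ.filter (fun x : F => (A * Q).eval x ≠ 0),
      ψ ((A * P).eval x / (A * Q).eval x) = ∑ x ∈ s.filter (fun x => A.eval x ≠ 0),
        ψ (P.eval x / Q.eval x) := by
    have hset : univ.filter (fun x : F => (A * Q).eval x ≠ 0) = s.filter (fun x => A.eval x ≠ 0) := by
      ext x
      simp only [hs, Finset.mem_filter, Finset.mem_univ, true_and, eval_mul, mul_ne_zero_iff]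
      tauto
    rw [hset]
    refine Finset.sum_congr rfl fun x hx => ?_
    simp only [Finset.mem_filter] at hx
    rw [eval_mul, eval_mul, mul_div_mul_left _ _ hx.2]
  rw [hfirst, hsplit, sub_add_cancel_left, norm_neg]
  refine (norm_sum_addChar_le_card ψ _ _).trans ?_
  have hsub : s.filter (fun x => ¬ A.eval x ≠ 0) ⊆ univ.filter (fun x : F => A.eval x = 0) := by
    intro x hx
    simp only [Finset.mem_filter, not_not] at hx
    exact Finset.mem_filter.2 ⟨Finset.mem_univ _, hx.2⟩
  exact_mod_cast (Finset.card_le_card hsub).trans (card_filter_eval_eq_zero_le hA)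

/-- **The twist `P ↦ P − rQ` does not change the modulus**: `ψ((P − rQ)/Q) = ψ(P/Q) ψ(−r)`.
[folklore] -/
theorem norm_sum_sub_C_mul (ψ : AddChar F ℂ) (P Q : F[X]) (r : F) :
    ‖∑ x ∈ univ.filter (fun x : F => Q.eval x ≠ 0), ψ ((P - C r * Q).eval x / Q.eval x)‖ =
      ‖∑ x ∈ univ.filter (fun x : F => Q.eval x ≠ 0), ψ (P.eval x / Q.eval x)‖ := by
  have h : ∀ x ∈ univ.filter (fun x : F => Q.eval x ≠ 0),
      ψ ((P - C r * Q).eval x / Q.eval x) = ψ (P.eval x / Q.eval x) * ψ (-r) := by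
    intro x hx
    rw [Finset.mem_filter] at hx
    rw [eval_sub, eval_mul, eval_C, sub_div, mul_div_cancel_right₀ _ hx.2, sub_eq_add_neg,
      AddChar.map_add_eq_mul]
  rw [Finset.sum_congr rfl h, ← Finset.sum_mul, norm_mul, AddChar.norm_apply, mul_one]

omit [Fintype F] [DecidableEq F] in
/-- `reflect N` is injective. [folklore] -/
theorem reflect_injective (N : ℕ) : Function.Injective (reflect N : F[X] → F[X]) := by
  intro f g h
  ext i
  have := congrArg (fun q : F[X] => q.coeff (revAt N i)) h
  simpa only [coeff_reflect, revAt_invol] using this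

omit [Fintype F] [DecidableEq F] in
/-- **Evaluation of the Möbius transform**: for `y ≠ 0` and `deg T ≤ N`,
`(reflect N T)(y) = yᴺ T(y⁻¹)`. [folklore] -/
theorem eval_reflect_eq {T : F[X]} {N : ℕ} (hT : T.natDegree ≤ N) {y : F} (hy : y ≠ 0) :
    (reflect N T).eval y = y ^ N * T.eval y⁻¹ := by
  letI : Invertible (y⁻¹ : F) := invertibleOfNonzero (inv_ne_zero hy)
  have h := eval₂_reflect_mul_pow (RingHom.id F) (y⁻¹ : F) N T hT
  rw [invOf_eq_inv, inv_inv] at h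
  change (reflect N T).eval y * y⁻¹ ^ N = T.eval y⁻¹ at h
  rw [← h, mul_comm, mul_assoc, ← mul_pow, inv_mul_cancel₀ hy, one_pow, mul_one]

/-- **The Möbius change of variable `x = c + 1/y`** (`c ∈ F`) changes the sum by
at most `2` (the terms `x = c` and `y = 0`): with `P̂ = reflect N (taylor c P)`,
`Q̂ = reflect N (taylor c Q)` (`N ≥ deg P, deg Q`),
`|Σ_{Q(x) ≠ 0} ψ(P(x)/Q(x)) − Σ_{Q̂(y) ≠ 0} ψ(P̂(y)/Q̂(y))| ≤ 2`. [folklore] -/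
theorem norm_sum_sub_moebius_le (ψ : AddChar F ℂ) {P Q : F[X]} {N : ℕ} (hP : P.natDegree ≤ N)
    (hQ : Q.natDegree ≤ N) (c : F) :
    ‖∑ x ∈ univ.filter (fun x : F => Q.eval x ≠ 0), ψ (P.eval x / Q.eval x) -
        ∑ y ∈ univ.filter (fun y : F => (reflect N (taylor c Q)).eval y ≠ 0),
          ψ ((reflect N (taylor c P)).eval y / (reflect N (taylor c Q)).eval y)‖ ≤ 2 := by
  set Ph := reflect N (taylor c P) with hPh
  set Qh := reflect N (taylor c Q) with hQh
  have hTP : (taylor c P).natDegree ≤ N := by rw [natDegree_taylor]; exact hP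
  have hTQ : (taylor c Q).natDegree ≤ N := by rw [natDegree_taylor]; exact hQ
  -- evaluation of the transforms at `y ≠ 0`
  have hevQ : ∀ y : F, y ≠ 0 → Qh.eval y = y ^ N * Q.eval (y⁻¹ + c) := fun y hy => by
    rw [hQh, eval_reflect_eq hTQ hy, taylor_eval]
  have hevP : ∀ y : F, y ≠ 0 → Ph.eval y = y ^ N * P.eval (y⁻¹ + c) := fun y hy => by
    rw [hPh, eval_reflect_eq hTP hy, taylor_eval]
  -- split off `x = c` on the left and `y = 0` on the right
  set sL := univ.filter (fun x : F => Q.eval x ≠ 0) with hsL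
  set sR := univ.filter (fun y : F => Qh.eval y ≠ 0) with hsR
  have hL := (Finset.sum_filter_add_sum_filter_not sL (fun x => x ≠ c)
    (fun x => ψ (P.eval x / Q.eval x))).symm
  have hR := (Finset.sum_filter_add_sum_filter_not sR (fun y => y ≠ 0)
    (fun y => ψ (Ph.eval y / Qh.eval y))).symm
  -- the main parts agree under `y ↦ y⁻¹ + c`
  have hmain : ∑ y ∈ sR.filter (fun y => y ≠ 0), ψ (Ph.eval y / Qh.eval y) =
      ∑ x ∈ sL.filter (fun x => x ≠ c), ψ (P.eval x / Q.eval x) := by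
    refine Finset.sum_nbij' (fun y => y⁻¹ + c) (fun x => (x - c)⁻¹) ?_ ?_ ?_ ?_ ?_
    · intro y hy
      simp only [hsR, hsL, Finset.mem_filter, Finset.mem_univ, true_and] at hy ⊢
      obtain ⟨hQy, hy0⟩ := hy
      rw [hevQ y hy0] at hQy
      exact ⟨(mul_ne_zero_iff.1 hQy).2, by simpa using hy0⟩
    · intro x hx
      simp only [hsR, hsL, Finset.mem_filter, Finset.mem_univ, true_and] at hx ⊢
      obtain ⟨hQx, hxc⟩ := hx
      have hxc' : x - c ≠ 0 := sub_ne_zero.2 hxc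
      refine ⟨?_, inv_ne_zero hxc'⟩
      rw [hevQ _ (inv_ne_zero hxc'), inv_inv, sub_add_cancel]
      exact mul_ne_zero (pow_ne_zero _ (inv_ne_zero hxc')) hQx
    · intro y _
      simp
    · intro x hx
      simp only [hsL, Finset.mem_filter, Finset.mem_univ, true_and] at hx
      have hxc' : x - c ≠ 0 := sub_ne_zero.2 hx.2
      rw [inv_inv, sub_add_cancel]
    · intro y hy
      simp only [hsR, Finset.mem_filter, Finset.mem_univ, true_and] at hy
      obtain ⟨hQy, hy0⟩ := hy
      rw [hevP y hy0, hevQ y hy0, mul_div_mul_left _ _ (pow_ne_zero _ hy0)]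
  rw [hL, hR, hmain]
  have e : (∑ x ∈ sL.filter (fun x => x ≠ c), ψ (P.eval x / Q.eval x) +
      ∑ x ∈ sL.filter (fun x => ¬ x ≠ c), ψ (P.eval x / Q.eval x)) -
      (∑ x ∈ sL.filter (fun x => x ≠ c), ψ (P.eval x / Q.eval x) +
        ∑ y ∈ sR.filter (fun y => ¬ y ≠ 0), ψ (Ph.eval y / Qh.eval y)) =
      ∑ x ∈ sL.filter (fun x => ¬ x ≠ c), ψ (P.eval x / Q.eval x) -
        ∑ y ∈ sR.filter (fun y => ¬ y ≠ 0), ψ (Ph.eval y / Qh.eval y) := by ring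
  rw [e]
  refine (norm_sub_le _ _).trans ?_
  have h1 : ‖∑ x ∈ sL.filter (fun x => ¬ x ≠ c), ψ (P.eval x / Q.eval x)‖ ≤ 1 := by
    refine (norm_sum_addChar_le_card ψ _ (fun x => P.eval x / Q.eval x)).trans ?_
    have : sL.filter (fun x => ¬ x ≠ c) ⊆ {c} := by
      intro x hx
      simp only [Finset.mem_filter, not_not] at hx
      rw [Finset.mem_singleton]; exact hx.2
    exact_mod_cast (Finset.card_le_card this).trans (Finset.card_singleton c).le
  have h2 : ‖∑ y ∈ sR.filter (fun y => ¬ y ≠ 0), ψ (Ph.eval y / Qh.eval y)‖ ≤ 1 := by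
    refine (norm_sum_addChar_le_card ψ _ (fun y => Ph.eval y / Qh.eval y)).trans ?_
    have : sR.filter (fun y => ¬ y ≠ 0) ⊆ {0} := by
      intro y hy
      simp only [Finset.mem_filter, not_not] at hy
      rw [Finset.mem_singleton]; exact hy.2
    exact_mod_cast (Finset.card_le_card this).trans (Finset.card_singleton (0 : F)).le
  linarith

omit [Fintype F] [DecidableEq F] in
/-- **Degree of the Möbius denominator**: `deg (reflect N (taylor c Q)) = N` when `Q(c) ≠ 0` and
`deg Q ≤ N`. [folklore] -/
theorem natDegree_reflect_taylor_eq {Q : F[X]} {N : ℕ} (hQ : Q.natDegree ≤ N) {c : F}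
    (hc : Q.eval c ≠ 0) : (reflect N (taylor c Q)).natDegree = N := by
  apply le_antisymm
  · refine natDegree_reflect_le.trans ?_
    rw [natDegree_taylor, max_eq_left hQ]
  · refine le_natDegree_of_ne_zero ?_
    rw [coeff_reflect, revAt_le le_rfl, Nat.sub_self, taylor_coeff_zero]
    exact hc

omit [Fintype F] [DecidableEq F] in
/-- `deg (reflect N (taylor c P)) ≤ N` when `deg P ≤ N`. [folklore] -/
theorem natDegree_reflect_taylor_le {P : F[X]} {N : ℕ} (hP : P.natDegree ≤ N) (c : F) :
    (reflect N (taylor c P)).natDegree ≤ N := by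
  refine natDegree_reflect_le.trans ?_
  rw [natDegree_taylor, max_eq_left hP]

omit [Fintype F] [DecidableEq F] in
/-- The Möbius transform detects proportionality: if `reflect N (taylor c P) = a · reflect N (taylor c Q)`
then `P = a · Q`. [folklore] -/
theorem eq_C_mul_of_reflect_taylor_eq {P Q : F[X]} {N : ℕ} {c a : F}
    (h : reflect N (taylor c P) = C a * reflect N (taylor c Q)) : P = C a * Q := by
  rw [← reflect_C_mul, ← taylor_C c a, ← taylor_mul] at h
  exact taylor_injective c (reflect_injective N h)

end Normalise

/-! ### §C2. Weil's bound without normalisation hypotheses -/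

section General

variable {p : ℕ} [Fact p.Prime]

/-- **Weil's bound for `Σ_{Q(x) ≠ 0} ψ(P(x)/Q(x))` over `𝔽_p`, general form.** For a primitive `ψ`,
`Q ≠ 0`, `deg P, deg Q ≤ D < p` and `P ≠ a Q` for every constant `a`:
`|Σ_{x ∈ 𝔽_p, Q(x) ≠ 0} ψ(P(x)/Q(x))| ≤ 2D √p + D + 2`.
Reduction to `norm_sum_div_le` by the Möbius change of variable, removal of the gcd
and a twist (§1). [cite: Weil1948] [cite: Schmidt1976, Ch. II Theorem 2E] -/
theorem norm_sum_le_of_ne_C_mul {ψ : AddChar (ZMod p) ℂ} (hψ : ψ.IsPrimitive) {P Q : (ZMod p)[X]}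
    {D : ℕ} (hP : P.natDegree ≤ D) (hQ : Q.natDegree ≤ D) (hDp : D < p) (hQ0 : Q ≠ 0)
    (hne : ∀ a : ZMod p, P ≠ C a * Q) :
    ‖∑ x ∈ univ.filter (fun x : ZMod p => Q.eval x ≠ 0), ψ (P.eval x / Q.eval x)‖ ≤
      2 * D * √(p : ℝ) + D + 2 := by
  classical
  have hp : p.Prime := Fact.out
  have hcardF : Fintype.card (ZMod p) = p := ZMod.card p
  -- the Möbius step
  set N := max P.natDegree Q.natDegree with hN
  have hPN : P.natDegree ≤ N := le_max_left _ _
  have hQN : Q.natDegree ≤ N := le_max_right _ _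
  have hND : N ≤ D := max_le hP hQ
  obtain ⟨c₁, hc₁⟩ := exists_eval_ne_zero hQ0 (by rw [hcardF]; omega)
  set Ph := reflect N (taylor c₁ P) with hPh
  set Qh := reflect N (taylor c₁ Q) with hQh
  have hQhdeg : Qh.natDegree = N := natDegree_reflect_taylor_eq hQN hc₁
  have hPhdeg : Ph.natDegree ≤ N := natDegree_reflect_taylor_le hPN c₁
  have hmoeb := norm_sum_sub_moebius_le ψ hPN hQN c₁
  have hQh0 : Qh ≠ 0 := by
    intro h0
    rw [h0] at hQhdeg
    -- `N = 0` would force `P, Q` constant, hence proportional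
    simp only [natDegree_zero] at hQhdeg
    have hQc : Q.natDegree = 0 := by omega
    have hPc : P.natDegree = 0 := by omega
    rw [Polynomial.natDegree_eq_zero] at hQc hPc
    obtain ⟨b, hb⟩ := hQc
    obtain ⟨a, ha⟩ := hPc
    have hb0 : b ≠ 0 := by rintro rfl; rw [C_0] at hb; exact hQ0 hb.symm
    refine hne (a * b⁻¹) ?_
    rw [← ha, ← hb, ← C_mul, mul_assoc, inv_mul_cancel₀ hb0, mul_one]
  -- the gcd step
  set G := GCDMonoid.gcd Ph Qh with hG
  have hG0 : G ≠ 0 := gcd_ne_zero_of_right hQh0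
  set P₂ := Ph / G with hP₂
  set Q₂ := Qh / G with hQ₂
  have hPhG : G * P₂ = Ph := EuclideanDomain.mul_div_cancel' hG0 (GCDMonoid.gcd_dvd_left _ _)
  have hQhG : G * Q₂ = Qh := EuclideanDomain.mul_div_cancel' hG0 (GCDMonoid.gcd_dvd_right _ _)
  have hcop : IsCoprime P₂ Q₂ := isCoprime_div_gcd_div_gcd hQh0
  have hQ₂0 : Q₂ ≠ 0 := right_div_gcd_ne_zero hQh0
  have hgcd := norm_sum_mul_sub_le ψ hG0 P₂ Q₂
  rw [hPhG, hQhG] at hgcd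
  -- degrees after the gcd step
  have hdegQ₂ : G.natDegree + Q₂.natDegree = N := by
    rw [← hQhdeg, ← hQhG, natDegree_mul hG0 hQ₂0]
  have hdegP₂ : P₂.natDegree ≤ Q₂.natDegree := by
    rcases eq_or_ne P₂ 0 with h0 | h0
    · rw [h0, natDegree_zero]; exact Nat.zero_le _
    · have : G.natDegree + P₂.natDegree ≤ N := by
        rw [← natDegree_mul hG0 h0, hPhG]; exact hPhdeg
      omega
  have hGN : G.natDegree ≤ N := by omega
  -- `deg Q₂ ≥ 1`, since `P ≠ a Q`
  have hQ₂1 : 1 ≤ Q₂.natDegree := by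
    by_contra hlt
    have hQ₂c : Q₂.natDegree = 0 := by omega
    have hP₂c : P₂.natDegree = 0 := by omega
    rw [Polynomial.natDegree_eq_zero] at hQ₂c hP₂c
    obtain ⟨b, hb⟩ := hQ₂c
    obtain ⟨a, ha⟩ := hP₂c
    have hb0 : b ≠ 0 := by rintro rfl; rw [C_0] at hb; exact hQ₂0 hb.symm
    apply hne (a * b⁻¹)
    apply eq_C_mul_of_reflect_taylor_eq (N := N) (c := c₁)
    rw [← hPh, ← hQh, ← hPhG, ← hQhG, ← ha, ← hb, C_mul]
    have hbb : C b⁻¹ * C b = (1 : (ZMod p)[X]) := by rw [← C_mul, inv_mul_cancel₀ hb0, C_1]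
    calc G * C a = G * C a * (C b⁻¹ * C b) := by rw [hbb, mul_one]
      _ = C a * C b⁻¹ * (G * C b) := by ring
  -- the twist
  obtain ⟨c₂, hc₂⟩ := exists_eval_ne_zero hQ₂0 (by rw [hcardF]; omega)
  set r := P₂.eval c₂ / Q₂.eval c₂ with hr
  set P₃ := P₂ - C r * Q₂ with hP₃
  have htwist := norm_sum_sub_C_mul ψ P₂ Q₂ r
  have hP₃deg : P₃.natDegree ≤ Q₂.natDegree := by
    rw [hP₃]
    refine (natDegree_sub_le _ _).trans (max_le hdegP₂ ?_)
    exact (natDegree_C_mul_le _ _)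
  have hcop₃ : IsCoprime P₃ Q₂ := by
    rw [hP₃, sub_eq_add_neg, ← neg_mul]
    exact hcop.add_mul_right_left _
  have hP₃c : P₃.eval c₂ = 0 := by
    rw [hP₃, eval_sub, eval_mul, eval_C, hr, div_mul_cancel₀ _ hc₂, sub_self]
  -- Weil's bound for the normalised pair
  have hW := norm_sum_div_le hψ hP₃deg hQ₂1
    (by omega) hcop₃ hP₃c hc₂
  rw [hP₃] at hW
  rw [htwist] at hW
  -- collect: `|S| ≤ |Ŝ| + 2 ≤ |S₂| + deg G + 2 ≤ (2 deg Q₂ - 1)√p + N + 2`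
  have hs : 0 ≤ √(p : ℝ) := Real.sqrt_nonneg _
  have h1 : ((2 * Q₂.natDegree - 1 : ℕ) : ℝ) ≤ 2 * D := by
    have : 2 * Q₂.natDegree - 1 ≤ 2 * D := by omega
    exact_mod_cast this
  have h2 : (G.natDegree : ℝ) ≤ D := by exact_mod_cast hGN.trans hND
  have e1 := (norm_sub_norm_le _ _).trans hmoeb
  have e2 := (norm_sub_norm_le _ _).trans hgcd
  have e3 := mul_le_mul_of_nonneg_right h1 hs
  linarith

end General

end RationalExpSum

end Literature.NumberTheory.LFunctions
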